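import Summits.BirchSwinnertonDyer.BirchSwinnertonDyer.Theorems.ThetaPartnerAtTwoSignedControlAtTwoCasselsOfPT
import Summits.BirchSwinnertonDyer.BirchSwinnertonDyer.Theorems.ThetaPartnerAtTwoSignedControlAtTwoTwistNotTorsionDoor
import HarnessLib

/-!
# K4 `SignedControlAtTwo` BY NAME from TWO printed facts: Greenberg's Prop. 4.12 and Poitou–Tate duality over `ℚ`
# (Cassels' Prop. 4.13 special case is now a consequence of Poitou–Tate — crux K4, line `eulerchar`, Cassels lane)

Crux K4 `SignedControlAtTwo` (stmt-BirchSwinnertonDyer-20309; routes `ThetaPartnerAtTwo` / `ResidualThetaTransportAtTwo`),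
line `eulerchar` v10: stub `stub_pubGreenbergPTTwo = casselsSurjectivity_H1Sigma ℚ ∧ prop412_noFiniteSubmodule_H1Sigma_of_rank_one
∧ poitouTate_selmerStructure_duality ℚ`, composition `SignedEC.TwistNotTorsion.signedControlAtTwo_of_pub2_of_poitouTate` (w2 g4).
With `SignedEC.CasselsPT.casselsSurjectivity_H1Sigma_of_poitouTate` (this seat: Cassels' theorem, Greenberg LNM 1716
Prop. 4.13 / p. 122, from `poitouTate_selmerStructure_duality`) the first conjunct follows from the third, and K4 closes BY
NAME from {Prop. 4.12, Poitou–Tate over `ℚ`}: `signedControlAtTwo_of_prop412_of_poitouTate` (route `ThetaPartnerAtTwo`)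
and `signedControlAtTwo_rtt_of_prop412_of_poitouTate` (route `ResidualThetaTransportAtTwo`). The K4 residue of record is
thereby {Poitou–Tate for Selmer structures over `ℚ` (Milne I Thm. 4.10 / Howard Thm. 2.1.11 — ONE generic global-duality
fact), Greenberg's Prop. 4.12 (the `Λ`-adic `H²` statement, `PROP412-SCOPING.md`)}.

THEOREMS ONLY (no definition, no named fact, no `sorry`); CONDITIONAL on the two named facts; BSD is not proved by any
of this.

References: [GreenbergLNM1716] §4 Props. 4.12–4.13, pp. 113–123; [MilneADT2006] I Thm. 4.10; [Howard2004HeegnerKolyvagin]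
Thm. 2.1.11; [BDKim2013] Cor. 3.15; [Kobayashi2003] Thm. 1.2.
-/

set_option autoImplicit false
-- the Theorems namespace of this sub repeats the summit name by design (D-0017 nested layout)
set_option linter.dupNamespace false

noncomputable section

open Literature.NumberTheory.EllipticCurves Literature.NumberTheory.GaloisCohomology

namespace Summit.BirchSwinnertonDyer.BirchSwinnertonDyer.Theorems.SignedEC.CasselsPT

/-- **K4 `SignedControlAtTwo` (route `ThetaPartnerAtTwo`'s decl, BY NAME) from Greenberg's Prop. 4.12 and
POITOU–TATE DUALITY over `ℚ`**: Cassels' theorem (`casselsSurjectivity_H1Sigma ℚ`) is supplied by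
`casselsSurjectivity_H1Sigma_of_poitouTate`, the rest is w2 g4's door `signedControlAtTwo_of_pub2_of_poitouTate`.
Conditional on the two named facts. [cite: GreenbergLNM1716, §4 Props. 4.12–4.13, pp. 113–123]
[cite: MilneADT2006, Ch. I, Thm. 4.10] [cite: BDKim2013, Cor. 3.15] [cite: Kobayashi2003, Thm. 1.2] -/
theorem signedControlAtTwo_of_prop412_of_poitouTate
    (h412 : Greenberg1999.prop412_noFiniteSubmodule_H1Sigma_of_rank_one)
    (hPT : poitouTate_selmerStructure_duality ℚ) :
    Summit.BirchSwinnertonDyer.BirchSwinnertonDyer.Theses.ThetaPartnerAtTwo.SignedControlAtTwo :=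
  Summit.BirchSwinnertonDyer.BirchSwinnertonDyer.Theorems.SignedEC.TwistNotTorsion.signedControlAtTwo_of_pub2_of_poitouTate
    (casselsSurjectivity_H1Sigma_of_poitouTate hPT) h412 hPT

/-- **The same for route `ResidualThetaTransportAtTwo`'s copy of the decl.** [cite: GreenbergLNM1716, §4 Props. 4.12–4.13]
[cite: MilneADT2006, Ch. I, Thm. 4.10] [cite: BDKim2013, Cor. 3.15] -/
theorem signedControlAtTwo_rtt_of_prop412_of_poitouTate
    (h412 : Greenberg1999.prop412_noFiniteSubmodule_H1Sigma_of_rank_one)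
    (hPT : poitouTate_selmerStructure_duality ℚ) :
    Summit.BirchSwinnertonDyer.BirchSwinnertonDyer.Theses.ResidualThetaTransportAtTwo.SignedControlAtTwo :=
  Summit.BirchSwinnertonDyer.BirchSwinnertonDyer.Theorems.SignedEC.TwistNotTorsion.signedControlAtTwo_rtt_of_pub2_of_poitouTate
    (casselsSurjectivity_H1Sigma_of_poitouTate hPT) h412 hPT

/-- **The v10 stub's conjunction from the two facts**: `Cassels ∧ Prop. 4.12 ∧ PT(ℚ)` ⟸ `Prop. 4.12 ∧ PT(ℚ)` — the
first conjunct of `stub_pubGreenbergPTTwo` is a theorem given the third. [cite: GreenbergLNM1716, §4 Prop. 4.13, p. 122] -/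
theorem cassels_and_prop412_and_poitouTate_of
    (h412 : Greenberg1999.prop412_noFiniteSubmodule_H1Sigma_of_rank_one)
    (hPT : poitouTate_selmerStructure_duality ℚ) :
    Greenberg1999.casselsSurjectivity_H1Sigma ℚ ∧ Greenberg1999.prop412_noFiniteSubmodule_H1Sigma_of_rank_one ∧
      poitouTate_selmerStructure_duality ℚ :=
  ⟨casselsSurjectivity_H1Sigma_of_poitouTate hPT, h412, hPT⟩

end Summit.BirchSwinnertonDyer.BirchSwinnertonDyer.Theorems.SignedEC.CasselsPT

end
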